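import Literature.NumberTheory.Transcendental.ManyCurveStdReduction
import Literature.NumberTheory.Transcendental.StdSubgroups
import HarnessLib

/-!
# `k`-lattice standard models: connected algebraic subgroups `K₀` are again standard models (adapted coordinates)

Topic `Literature/NumberTheory/Transcendental`; sixth file of the unit
`provefact-Literature.NumberTheory.Transcendental.H-0a3eb64689` (fact
`Literature.NumberTheory.Transcendental.HuberWustholzManyCurvePeriods`, `ManyCurvePeriods.lean`),
after `ManyCurveStdReduction.lean`. It introduces NO named fact. It is the family counterpart of
the first half of the one-lattice `StdSubgroups.lean` (`GaGmE.Std.SubData`) and of the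
two-lattice `TwoCurveInduction.lean` (up to `SubData.card_eq`): for the family standard models
`M = 𝔾ₘ^β × P` of `ManyCurveStd.lean` (lattice family `L : J → PeriodPair`, class map
`cls : γ → J`) and a connected algebraic subgroup `K₀ = H_{(A₀, C₀, Ξ₀)}`, coordinates on `Lie K₀`
presenting `K₀` as a family standard model for the SAME lattice family — the second half of the
induction over quotients AND subgroups of Baker–Wüstholz 2007, §6.8, p. 115.

## What is proved here (everything; no `sorry`, no new `def … : Prop`)

* `GaGmEFam.Std.Semistable.finrank_eq_zero_of_le` — a semistable proper `𝔟` contains no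
  non-zero algebraic Lie subalgebra (Baker–Wüstholz 2007, §6.7);
* `GaGmEFam.Std.offClass`, `mem_perpQ_sup_offClass` — the class-`i` solutions
  `V_i = {p ∈ ℚ^γ ; p ⊥ C₀, supp p ⊆ cls⁻¹(i)} = (C₀ + ℚ^{γ ∖ cls⁻¹(i)})^⊥` of a block-diagonal
  `C₀` (`C₀^⊥ = ⊕ᵢ Vᵢ`, `restr_mem_perpQ_sup_offClass`);
* `GaGmEFam.Std.SubData` — coordinates on `K₀`: integer vectors `a⁽ʲ⁾` spanning `A₀^⊥` with an
  integer left inverse, CLASS BY CLASS integer vectors `m⁽ⁱ,ᵇ⁾` spanning `Vᵢ` with integer left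
  inverses (`GaGmE.Std.exists_unimodular_with_leftInverse` applied to each `Vᵢ`; the abelian
  subvariety of `∏_b E_{cls b}` cut out by `C₀` is `∏ᵢ Eᵢ^{nᵢ}`, new block index `Σ i, Fin nᵢ`
  with class map `Sigma.fst`), a `ℚ̄`-basis `σ⁽ᵉ⁾` of `Ξ₀^⊥` and the push-out matrix `κ'`
  (`exists_κS`, `nonempty_subData`); the joint families `mvv` (classwise supported, killed by and
  spanning against `C₀`: `mvv_perp`, `mvv_span`) and `pCC` (classwise restricted left inverses,
  `pCC_spec`);
* the embedding `ι : Lie(model) → Lie M` (`ι_injective`, `ι_mem_tangent`, `exists_eq_ι`,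
  `range_ι`, `card_eq`: `ι` is an isomorphism onto `Lie K₀`).

The remaining half of the subgroup step (`ι_mem_ker`, `mem_AlgTors_of_ι`, `push`, `transport`, the
induction `mem_ker_of_semistable_card` and `HuberWustholzManyCurvePeriods_of_stableClosing`) is
the port of the second half of `TwoCurveInduction.lean` on top of this file.

## References

* A. Baker, G. Wüstholz, *Logarithmic Forms and Diophantine Geometry*, New Math. Monogr. 9, CUP
  2007: §6.7 (index, semistability), §6.8 (p. 115: passage to `G^*` and to `B ∩ ker π`).
  [BakerWustholz2007]
* A. Huber, G. Wüstholz, *Transcendence and Linear Relations of 1-Periods*, Cambridge Tracts 227,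
  CUP 2022: Thm. 15.3 (1) (p. 145), Thm. 6.2. [HuberWustholz2022]
-/

noncomputable section

open Complex Module Submodule

namespace Literature.NumberTheory.Transcendental

namespace GaGmEFam

namespace Std

open LiePresentation
open GaGmE (Kbar exists_unimodular_basis linearIndependent_ofK)
open GaGmE.Std (iy iz is coords coords_iy coords_iz coords_is sum_blocks perpQ perpK
  exists_unimodular_with_leftInverse exists_sv eq_zero_of_index_le_of_lt)

variable {J : Type} [Fintype J] [DecidableEq J] {β γ δ : Type}

/-! ### A semistable proper subspace contains no non-zero algebraic Lie subalgebra -/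

section NoSubgroup

variable [Fintype β] [Fintype γ] [Fintype δ] {cls : γ → J} {κM : δ → γ → Kbar}

omit [Fintype J] in
/-- **No non-zero algebraic Lie subalgebra inside a semistable proper subspace** (`ℚ̄`-data):
the index inequality with `𝔟 ∩ 𝔨 = 𝔨` forces `dim 𝔨 = 0` (as `GaGmE.Std.Semistable.finrank_eq_zero_of_le`).
[cite: BakerWustholz2007, §6.7 (index and semistability)] -/
theorem Semistable.finrank_eq_zero_of_le {𝔟 : Submodule ℂ (β ⊕ (γ ⊕ δ) → ℂ)}
    (hss : Semistable cls κM 𝔟) (h𝔟 : 𝔟 ≠ ⊤) (D : SubgroupData β γ δ cls κM)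
    (hle : D.tangent ≤ 𝔟) : Module.finrank ℂ D.tangent = 0 := by
  have hDtop : D.tangent ≠ ⊤ := fun h => h𝔟 (eq_top_iff.mpr (h ▸ hle))
  have hineq := hss D.tangent ⟨D, rfl⟩ hDtop
  rw [inf_eq_right.mpr hle] at hineq
  have hkb : Module.finrank ℂ D.tangent ≤ Module.finrank ℂ 𝔟 := Submodule.finrank_mono hle
  have hbn : Module.finrank ℂ 𝔟 < Fintype.card (β ⊕ (γ ⊕ δ)) := by
    have h1 : Module.finrank ℂ 𝔟 < Module.finrank ℂ (β ⊕ (γ ⊕ δ) → ℂ) :=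
      Submodule.finrank_lt h𝔟
    simpa using h1
  exact eq_zero_of_index_le_of_lt hkb hbn hineq

end NoSubgroup

/-! ### The classwise solution spaces `Vᵢ = (C₀ + ℚ^{γ ∖ cls⁻¹(i)})^⊥` -/

section OffClass

variable [Fintype γ] (cls : γ → J)

omit [Fintype J] in
/-- The vectors of `ℚ^γ` vanishing on the blocks of class `i` (supported off class `i`).
[folklore] -/
def offClass (i : J) : Submodule ℚ (γ → ℚ) where
  carrier := {p | ∀ k, cls k = i → p k = 0}
  zero_mem' := fun _ _ => rfl
  add_mem' := by
    intro u v hu hv k hk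
    simp [hu k hk, hv k hk]
  smul_mem' := by
    intro c u hu k hk
    simp [hu k hk]

omit [Fintype J] in
/-- **The class-`i` solutions.** `p ∈ (C + offClass i)^⊥` iff `p ⊥ C` and `p` is supported in
class `i`. [folklore] -/
theorem mem_perpQ_sup_offClass {C : Submodule ℚ (γ → ℚ)} {i : J} {p : γ → ℚ} :
    p ∈ perpQ (C ⊔ offClass cls i) ↔
      (∀ c ∈ C, ∑ k, c k * p k = 0) ∧ ∀ k, cls k ≠ i → p k = 0 := by
  classical
  constructor
  · intro hp
    refine ⟨fun c hc => hp c (Submodule.mem_sup_left hc), fun k hk => ?_⟩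
    have hmem : (Pi.single k 1 : γ → ℚ) ∈ offClass cls i := by
      intro k' hk'
      have : k' ≠ k := fun h => hk (h ▸ hk')
      simp [Pi.single_eq_of_ne this]
    have := hp _ (Submodule.mem_sup_right hmem)
    rw [Finset.sum_eq_single k (fun k' _ hk' => by simp [Pi.single_eq_of_ne hk'])
      (fun h => absurd (Finset.mem_univ k) h)] at this
    simpa using this
  · rintro ⟨hC, hsupp⟩ q hq
    obtain ⟨c, hc, o, ho, rfl⟩ := Submodule.mem_sup.mp hq
    simp only [Pi.add_apply, add_mul, Finset.sum_add_distrib, hC c hc, zero_add]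
    refine Finset.sum_eq_zero fun k _ => ?_
    by_cases hk : cls k = i
    · rw [ho k hk, zero_mul]
    · rw [hsupp k hk, mul_zero]

omit [Fintype J] in
/-- A sum against a restriction is the sum of the restricted form. [folklore] -/
theorem sum_mul_restr (i : J) (c p : γ → ℚ) :
    ∑ k, c k * restr cls i p k = ∑ k, restr cls i c k * p k := by
  refine Finset.sum_congr rfl fun k _ => ?_
  by_cases hk : cls k = i
  · rw [restr_apply_of_eq cls hk, restr_apply_of_eq cls hk]
  · rw [restr_apply_of_ne cls hk, restr_apply_of_ne cls hk, mul_zero, zero_mul]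

omit [Fintype J] in
/-- The class restrictions of a solution of the `C₀`-equations (block-diagonal `C₀`) are classwise
solutions. [folklore] -/
theorem restr_mem_perpQ_sup_offClass {C : Submodule ℚ (γ → ℚ)} (hC : IsBlockDiag cls C)
    {p : γ → ℚ} (hp : ∀ c ∈ C, ∑ k, c k * p k = 0) (i : J) :
    restr cls i p ∈ perpQ (C ⊔ offClass cls i) := by
  rw [mem_perpQ_sup_offClass]
  refine ⟨fun c hc => ?_, fun k hk => restr_apply_of_ne cls hk⟩
  rw [sum_mul_restr]
  exact hp _ (hC c hc i)

end OffClass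

/-! ### Coordinates on a connected algebraic subgroup `K₀` -/

section Sub

variable [Fintype β] [Fintype γ] [Fintype δ] {cls : γ → J} {κM : δ → γ → Kbar}

/-- **Coordinates of `Lie K₀` presenting `K₀ = H_{(A₀, C₀, Ξ₀)}` as a family standard model**:
integer vectors `a⁽ʲ⁾` spanning `A₀^⊥` with an integer left inverse, class by class integer
vectors `m⁽ⁱ,ᵇ⁾` spanning the class-`i` solutions `Vᵢ` with integer left inverses (the abelian
subvariety of `∏_b E_{cls b}` cut out by `C₀` is `∏ᵢ Eᵢ^{nᵢ}`), a linearly independent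
`ℚ̄`-family `σ⁽ᵉ⁾` spanning `Ξ₀^⊥`, and the push-out matrix `κ'` of the subgroup over the joint
family (as `GaGmE.Std.SubData` for one lattice). [folklore] -/
structure SubData (D₀ : SubgroupData β γ δ cls κM) where
  /-- number of `𝔾ₘ`-coordinates of `K₀` -/
  nA : ℕ
  /-- the integer vectors `a⁽ʲ⁾ ∈ A₀^⊥` -/
  av : Fin nA → β → ℤ
  av_perp : ∀ q ∈ D₀.A, ∀ j, ∑ i, q i * (av j i : ℚ) = 0
  av_span : ∀ p : β → ℚ, (∀ q ∈ D₀.A, ∑ i, q i * p i = 0) →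
    p ∈ Submodule.span ℚ (Set.range fun j i => (av j i : ℚ))
  /-- the integer left inverse -/
  pA : Fin nA → β → ℤ
  pA_spec : ∀ j j', ∑ i, av j i * pA j' i = if j = j' then 1 else 0
  /-- number of `Eᵢ`-coordinates of `K₀`, class by class -/
  n : J → ℕ
  /-- the integer vectors `m⁽ⁱ,ᵇ⁾ ∈ Vᵢ` -/
  mv : (i : J) → Fin (n i) → γ → ℤ
  mv_perp : ∀ c ∈ D₀.C, ∀ i b, ∑ k, c k * (mv i b k : ℚ) = 0
  mv_supp : ∀ i b k, cls k ≠ i → mv i b k = 0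
  mv_span : ∀ (i : J) (p : γ → ℚ), (∀ c ∈ D₀.C, ∑ k, c k * p k = 0) →
    (∀ k, cls k ≠ i → p k = 0) → p ∈ Submodule.span ℚ (Set.range fun b k => (mv i b k : ℚ))
  /-- the integer left inverses -/
  pC : (i : J) → Fin (n i) → γ → ℤ
  pC_spec : ∀ i b b', ∑ k, mv i b k * pC i b' k = if b = b' then 1 else 0
  /-- number of vector-group coordinates of `K₀` -/
  nΞ : ℕ
  /-- the `ℚ̄`-vectors `σ⁽ᵉ⁾ ∈ Ξ₀^⊥` -/
  sv : Fin nΞ → δ → Kbar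
  sv_perp : ∀ ξ ∈ D₀.Ξ, ∀ e, ∑ x, ξ x * sv e x = 0
  sv_span : ∀ u : δ → Kbar, (∀ ξ ∈ D₀.Ξ, ∑ x, ξ x * u x = 0) →
    u ∈ Submodule.span Kbar (Set.range sv)
  sv_indep : LinearIndependent Kbar sv
  /-- the push-out matrix `κ'` of the subgroup -/
  κS : Fin nΞ → (Σ i, Fin (n i)) → Kbar
  κS_spec : ∀ (b : Σ i, Fin (n i)) x, ∑ k, κM x k * (mv b.1 b.2 k : Kbar) = ∑ e, κS e b * sv e x

omit [Fintype J] in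
/-- The push-out matrix of the subgroup: `κ ∘ m⁽ⁱ,ᵇ⁾ ∈ Ξ₀^⊥` is a combination of the `σ⁽ᵉ⁾`
(compatibility `ξ ∘ κ ∈ span C₀` and `m⁽ⁱ,ᵇ⁾ ⊥ C₀`). [folklore] -/
theorem exists_κS (D₀ : SubgroupData β γ δ cls κM) {n : J → ℕ} (mv : (i : J) → Fin (n i) → γ → ℤ)
    (hmv : ∀ (b : Σ i, Fin (n i)), ∀ c ∈ D₀.C, ∑ k, c k * (mv b.1 b.2 k : ℚ) = 0)
    {m : ℕ} {sv : Fin m → δ → Kbar}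
    (sv_span : ∀ u ∈ perpK D₀.Ξ, u ∈ Submodule.span Kbar (Set.range sv)) :
    ∃ κS : Fin m → (Σ i, Fin (n i)) → Kbar,
      ∀ b x, ∑ k, κM x k * (mv b.1 b.2 k : Kbar) = ∑ e, κS e b * sv e x := by
  have hκmem : ∀ b : Σ i, Fin (n i), (fun x => ∑ k, κM x k * (mv b.1 b.2 k : Kbar)) ∈ perpK D₀.Ξ := by
    intro b ξ hξ
    have hc := D₀.compat ξ hξ
    have key : ∀ lam ∈ Submodule.span Kbar ((fun c : γ → ℚ => fun k => (c k : Kbar)) ''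
        (D₀.C : Set (γ → ℚ))),
        ∑ k, lam k * (mv b.1 b.2 k : Kbar) = 0 := by
      intro lam hlam
      induction hlam using Submodule.span_induction with
      | mem x hx =>
        obtain ⟨c, hcC, rfl⟩ := hx
        have h0 : ∑ k, c k * (mv b.1 b.2 k : ℚ) = 0 := hmv b c hcC
        have := congrArg (fun r : ℚ => (r : Kbar)) h0
        push_cast at this
        exact this
      | zero => simp
      | add x y _ _ hx hy =>
        simp only [Pi.add_apply, add_mul, Finset.sum_add_distrib, hx, hy, add_zero]
      | smul r x _ hx =>
        simp only [Pi.smul_apply, smul_eq_mul, mul_assoc, ← Finset.mul_sum, hx, mul_zero]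
    have h1 := key _ hc
    show ∑ x, ξ x * ∑ k, κM x k * (mv b.1 b.2 k : Kbar) = 0
    rw [← h1]
    simp only [Finset.mul_sum, Finset.sum_mul]
    rw [Finset.sum_comm]
    exact Finset.sum_congr rfl fun k _ => Finset.sum_congr rfl fun x _ => by ring
  have hκ : ∀ b : Σ i, Fin (n i), ∃ r : Fin m → Kbar,
      (∑ e, r e • sv e) = fun x => ∑ k, κM x k * (mv b.1 b.2 k : Kbar) := by
    intro b
    have := sv_span _ (hκmem b)
    rwa [Submodule.mem_span_range_iff_exists_fun] at this
  choose κS hκS using hκ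
  refine ⟨fun e b => κS b e, fun b x => ?_⟩
  have := congr_fun (hκS b) x
  simp only [Finset.sum_apply, Pi.smul_apply, smul_eq_mul] at this
  rw [← this]

omit [Fintype J] in
/-- Adapted coordinates on `K₀` exist. [folklore] -/
theorem nonempty_subData (D₀ : SubgroupData β γ δ cls κM) : Nonempty (SubData D₀) := by
  obtain ⟨nA, av, pA, hav, hspanA, hpA⟩ := exists_unimodular_with_leftInverse (perpQ D₀.A)
  have hcls := fun i => exists_unimodular_with_leftInverse (perpQ (D₀.C ⊔ offClass cls i))
  choose n mv pC hmv hspanC hpC using hcls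
  have mv_perp : ∀ c ∈ D₀.C, ∀ i b, ∑ k, c k * (mv i b k : ℚ) = 0 := fun c hc i b =>
    ((mem_perpQ_sup_offClass cls).mp (hmv i b)).1 c hc
  have mv_supp : ∀ i b k, cls k ≠ i → mv i b k = 0 := fun i b k hk => by
    have h0 : ((mv i b k : ℤ) : ℚ) = 0 := ((mem_perpQ_sup_offClass cls).mp (hmv i b)).2 k hk
    exact_mod_cast h0
  have mv_span : ∀ (i : J) (p : γ → ℚ), (∀ c ∈ D₀.C, ∑ k, c k * p k = 0) →
      (∀ k, cls k ≠ i → p k = 0) → p ∈ Submodule.span ℚ (Set.range fun b k => (mv i b k : ℚ)) :=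
    fun i p hp hsupp => hspanC i p ((mem_perpQ_sup_offClass cls).mpr ⟨hp, hsupp⟩)
  obtain ⟨nΞ, sv, sv_mem, sv_span, sv_indep⟩ := exists_sv D₀.Ξ
  have hmvv : ∀ (b : Σ i, Fin (n i)), ∀ c ∈ D₀.C, ∑ k, c k * (mv b.1 b.2 k : ℚ) = 0 :=
    fun b c hc => mv_perp c hc b.1 b.2
  obtain ⟨κS, hκS⟩ := exists_κS D₀ mv hmvv sv_span
  exact ⟨⟨nA, av, fun q hq j => hav j q hq, fun p hp => hspanA p hp, pA, hpA,
    n, mv, mv_perp, mv_supp, mv_span, pC, hpC,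
    nΞ, sv, fun ξ hξ e => sv_mem e ξ hξ, fun u hu => sv_span u hu, sv_indep, κS, hκS⟩⟩

namespace SubData

variable {D₀ : SubgroupData β γ δ cls κM} (S : SubData D₀)

/-- The block index of the model of `K₀`: class `i` has `nᵢ` blocks. [folklore] -/
abbrev B' : Type := Σ i, Fin (S.n i)

/-- The class map of the model of `K₀`. [folklore] -/
abbrev cls' : S.B' → J := Sigma.fst

/-- The index type of the coordinates of `Lie K₀`. [folklore] -/
abbrev σ' : Type := Fin S.nA ⊕ (S.B' ⊕ Fin S.nΞ)

/-- The joint family `m⁽ⁱ,ᵇ⁾`. [folklore] -/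
def mvv (b : S.B') : γ → ℤ := S.mv b.1 b.2

/-- The joint family of the classwise restricted left inverses. [folklore] -/
def pCC (b : S.B') (k : γ) : ℤ := if cls k = b.1 then S.pC b.1 b.2 k else 0

omit [Fintype J] in
/-- The joint family, unfolded. [folklore] -/
theorem mvv_apply (b : S.B') (k : γ) : S.mvv b k = S.mv b.1 b.2 k := rfl

omit [Fintype J] in
/-- The rows of the joint family are supported in their class. [folklore] -/
theorem mvv_supp {b : S.B'} {k : γ} (h : cls k ≠ b.1) : S.mvv b k = 0 := S.mv_supp b.1 b.2 k h

omit [Fintype J] in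
/-- The joint family is killed by `C₀`. [folklore] -/
theorem mvv_perp (c : γ → ℚ) (hc : c ∈ D₀.C) (b : S.B') : ∑ k, c k * (S.mvv b k : ℚ) = 0 :=
  S.mv_perp c hc b.1 b.2

/-- The joint family spans `C₀^⊥` over `ℚ` (class by class). [folklore] -/
theorem mvv_span (p : γ → ℚ) (hp : ∀ c ∈ D₀.C, ∑ k, c k * p k = 0) :
    p ∈ Submodule.span ℚ (Set.range fun b k => (S.mvv b k : ℚ)) := by
  rw [← sum_restr cls p]
  refine Submodule.sum_mem _ fun i _ => ?_
  have hi := S.mv_span i (restr cls i p)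
    (fun c hc => by rw [sum_mul_restr]; exact hp _ (D₀.blockDiag c hc i))
    (fun k hk => restr_apply_of_ne cls hk)
  refine Submodule.span_mono ?_ hi
  rintro _ ⟨b, rfl⟩
  exact ⟨⟨i, b⟩, rfl⟩

omit [Fintype J] in
/-- The left inverse of the joint family. [folklore] -/
theorem pCC_spec (b b' : S.B') : ∑ k, S.mvv b k * S.pCC b' k = if b = b' then 1 else 0 := by
  classical
  obtain ⟨i, j⟩ := b
  obtain ⟨i', j'⟩ := b'
  by_cases h : i = i'
  · subst h
    have e : ∑ k, S.mvv ⟨i, j⟩ k * S.pCC ⟨i, j'⟩ k = ∑ k, S.mv i j k * S.pC i j' k := by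
      refine Finset.sum_congr rfl fun k _ => ?_
      simp only [mvv, pCC]
      by_cases hk : cls k = i
      · rw [if_pos hk]
      · rw [if_neg hk, S.mv_supp i j k hk, zero_mul, zero_mul]
    rw [e, S.pC_spec i j j']
    by_cases hj : j = j'
    · subst hj; simp
    · rw [if_neg hj, if_neg (fun h => hj (by cases h; rfl))]
  · have e : ∑ k, S.mvv ⟨i, j⟩ k * S.pCC ⟨i', j'⟩ k = 0 := by
      refine Finset.sum_eq_zero fun k _ => ?_
      simp only [mvv, pCC]
      by_cases hk : cls k = i'
      · rw [S.mv_supp i j k (by rw [hk]; exact Ne.symm h), zero_mul]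
      · rw [if_neg hk, mul_zero]
    rw [e, if_neg (fun h' => h (congrArg Sigma.fst h'))]

/-- The embedding `ι : Lie K₀ → Lie M` in adapted coordinates. [folklore] -/
def ι : (S.σ' → ℂ) →ₗ[ℂ] (β ⊕ (γ ⊕ δ) → ℂ) where
  toFun w := coords (fun i => ∑ j, (S.av j i : ℂ) * w (iy j))
    (fun k => ∑ b, (S.mvv b k : ℂ) * w (iz b))
    (fun x => ∑ e, (S.sv e x : ℂ) * w (is e))
  map_add' v w := by
    funext x
    rcases x with i | k | x
    · simp only [coords, Sum.elim_inl, Pi.add_apply, mul_add, Finset.sum_add_distrib]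
    · simp only [coords, Sum.elim_inr, Sum.elim_inl, Pi.add_apply, mul_add,
        Finset.sum_add_distrib]
    · simp only [coords, Sum.elim_inr, Pi.add_apply, mul_add, Finset.sum_add_distrib]
  map_smul' c w := by
    funext x
    rcases x with i | k | x
    · simp only [coords, Sum.elim_inl, Pi.smul_apply, smul_eq_mul, RingHom.id_apply,
        Finset.mul_sum]
      exact Finset.sum_congr rfl fun i _ => by ring
    · simp only [coords, Sum.elim_inr, Sum.elim_inl, Pi.smul_apply, smul_eq_mul,
        RingHom.id_apply, Finset.mul_sum]
      exact Finset.sum_congr rfl fun i _ => by ring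
    · simp only [coords, Sum.elim_inr, Pi.smul_apply, smul_eq_mul, RingHom.id_apply,
        Finset.mul_sum]
      exact Finset.sum_congr rfl fun i _ => by ring

/-- The `y`-block of `ι`. [folklore] -/
theorem ι_iy (w) (i : β) : S.ι w (iy i) = ∑ j, (S.av j i : ℂ) * w (iy j) := rfl
/-- The `z`-block of `ι`. [folklore] -/
theorem ι_iz (w) (k : γ) : S.ι w (iz k) = ∑ b, (S.mvv b k : ℂ) * w (iz b) := rfl
/-- The `s`-block of `ι`. [folklore] -/
theorem ι_is (w) (x : δ) : S.ι w (is x) = ∑ e, (S.sv e x : ℂ) * w (is e) := rfl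

/-- The integer left inverse on the `y`-block. [folklore] -/
theorem pA_ι (w : S.σ' → ℂ) (j' : Fin S.nA) : ∑ i, (S.pA j' i : ℂ) * S.ι w (iy i) = w (iy j') := by
  simp only [ι_iy, Finset.mul_sum]
  rw [Finset.sum_comm]
  have key : ∀ j, ∑ i, (S.pA j' i : ℂ) * ((S.av j i : ℂ) * w (iy j)) =
      (if j = j' then 1 else 0) * w (iy j) := by
    intro j
    have h := congrArg (fun n : ℤ => (n : ℂ)) (S.pA_spec j j')
    push_cast at h
    rw [← h, Finset.sum_mul]
    exact Finset.sum_congr rfl fun i _ => by ring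
  simp only [key, ite_mul, one_mul, zero_mul, Finset.sum_ite_eq', Finset.mem_univ, if_true]

/-- The integer left inverse on the `z`-block. [folklore] -/
theorem pC_ι (w : S.σ' → ℂ) (b' : S.B') :
    ∑ k, (S.pCC b' k : ℂ) * S.ι w (iz k) = w (iz b') := by
  simp only [ι_iz, Finset.mul_sum]
  rw [Finset.sum_comm]
  have key : ∀ b, ∑ k, (S.pCC b' k : ℂ) * ((S.mvv b k : ℂ) * w (iz b)) =
      (if b = b' then 1 else 0) * w (iz b) := by
    intro b
    have h := congrArg (fun n : ℤ => (n : ℂ)) (S.pCC_spec b b')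
    push_cast at h
    rw [← h, Finset.sum_mul]
    exact Finset.sum_congr rfl fun k _ => by ring
  simp only [key, ite_mul, one_mul, zero_mul, Finset.sum_ite_eq', Finset.mem_univ, if_true]

omit [Fintype J] in
/-- The `σ⁽ᵉ⁾` are linearly independent over `ℂ`. [folklore] -/
theorem eq_zero_of_sv_sum {c : Fin S.nΞ → ℂ} (h : ∀ x, ∑ e, (S.sv e x : ℂ) * c e = 0) : c = 0 := by
  have hind := linearIndependent_ofK (L := ℂ) S.sv_indep
  have := Fintype.linearIndependent_iff.mp hind c (by
    funext x
    simp only [Finset.sum_apply, Pi.smul_apply, smul_eq_mul, Pi.zero_apply,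
      LiePresentation.ofK_apply]
    rw [← h x]
    exact Finset.sum_congr rfl fun e _ => by rw [mul_comm]; rfl)
  exact funext this

/-- `ι` is injective. [folklore] -/
theorem ι_injective : Function.Injective S.ι := by
  rw [← LinearMap.ker_eq_bot, LinearMap.ker_eq_bot']
  intro w hw
  funext t
  rcases t with j' | b' | e'
  · have := S.pA_ι w j'; rw [hw] at this
    show w (iy j') = 0
    simpa using this.symm
  · have := S.pC_ι w b'; rw [hw] at this
    show w (iz b') = 0
    simpa using this.symm
  · have hc : (fun e => w (is e)) = 0 := by
      refine S.eq_zero_of_sv_sum fun x => ?_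
      have := congr_fun hw (is x)
      rw [ι_is] at this
      simpa using this
    exact congr_fun hc e'

/-- The image of `ι` lies in `Lie K₀`. [folklore] -/
theorem ι_mem_tangent (w : S.σ' → ℂ) : S.ι w ∈ D₀.tangent := by
  rw [SubgroupData.mem_tangent_iff]
  refine ⟨fun q hq => ?_, fun c hc => ?_, fun ξ hξ => ?_⟩
  · simp only [ι_iy, Finset.mul_sum]
    rw [Finset.sum_comm]
    refine Finset.sum_eq_zero fun j _ => ?_
    have h := congrArg (fun r : ℚ => (r : ℂ)) (S.av_perp q hq j)
    push_cast at h
    have : ∑ i, (q i : ℂ) * ((S.av j i : ℂ) * w (iy j)) =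
        (∑ i, (q i : ℂ) * (S.av j i : ℂ)) * w (iy j) := by
      rw [Finset.sum_mul]; exact Finset.sum_congr rfl fun i _ => by ring
    rw [this, h, zero_mul]
  · simp only [ι_iz, Finset.mul_sum]
    rw [Finset.sum_comm]
    refine Finset.sum_eq_zero fun b _ => ?_
    have h := congrArg (fun r : ℚ => (r : ℂ)) (S.mvv_perp c hc b)
    push_cast at h
    have : ∑ k, (c k : ℂ) * ((S.mvv b k : ℂ) * w (iz b)) =
        (∑ k, (c k : ℂ) * (S.mvv b k : ℂ)) * w (iz b) := by
      rw [Finset.sum_mul]; exact Finset.sum_congr rfl fun k _ => by ring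
    rw [this, h, zero_mul]
  · simp only [ι_is, Finset.mul_sum]
    rw [Finset.sum_comm]
    refine Finset.sum_eq_zero fun e _ => ?_
    have h := congrArg (algebraMap Kbar ℂ) (S.sv_perp ξ hξ e)
    rw [map_sum, map_zero] at h
    simp only [map_mul] at h
    have : ∑ x, (ξ x : ℂ) * ((S.sv e x : ℂ) * w (is e)) =
        (∑ x, (ξ x : ℂ) * (S.sv e x : ℂ)) * w (is e) := by
      rw [Finset.sum_mul]; exact Finset.sum_congr rfl fun x _ => by ring
    rw [this]
    exact mul_eq_zero_of_left h _

omit [Fintype J] in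
/-- Complex solutions of the `A₀`-equations are combinations of the `a⁽ʲ⁾`. [folklore] -/
theorem exists_coeff_y {y : β → ℂ} (hy : ∀ q ∈ D₀.A, ∑ i, (q i : ℂ) * y i = 0) :
    ∃ c : Fin S.nA → ℂ, y = fun i => ∑ j, (S.av j i : ℂ) * c j := by
  have hmem : y ∈ solSpace ℚ (L := ℂ) (D₀.A : Set (β → ℚ)) := by
    intro q hq
    simp only [pair, eq_ratCast]
    exact hy q hq
  rw [solSpace_eq_span] at hmem
  have hle : span ℂ (ofK ℚ (L := ℂ) '' {w : β → ℚ | ∀ q ∈ (D₀.A : Set (β → ℚ)), ∑ i, q i * w i = 0}) ≤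
      span ℂ (Set.range fun j => fun i => (S.av j i : ℂ)) := by
    refine span_le.mpr ?_
    rintro _ ⟨w, hw, rfl⟩
    have hw' := S.av_span w hw
    rw [Submodule.mem_span_range_iff_exists_fun] at hw'
    obtain ⟨r, hr⟩ := hw'
    have e : ofK ℚ (L := ℂ) w = ∑ j, (r j : ℂ) • fun i => (S.av j i : ℂ) := by
      funext i
      have := congr_fun hr i
      simp only [Finset.sum_apply, Pi.smul_apply, smul_eq_mul] at this
      simp only [ofK_apply, eq_ratCast, Finset.sum_apply, Pi.smul_apply, smul_eq_mul]
      rw [← this]; push_cast; rfl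
    rw [e]
    exact Submodule.sum_mem _ fun j _ => Submodule.smul_mem _ _ (subset_span ⟨j, rfl⟩)
  have := hle hmem
  rw [Submodule.mem_span_range_iff_exists_fun] at this
  obtain ⟨c, hc⟩ := this
  refine ⟨c, ?_⟩
  funext i
  have := congr_fun hc i
  simp only [Finset.sum_apply, Pi.smul_apply, smul_eq_mul] at this
  rw [← this]
  exact Finset.sum_congr rfl fun j _ => by ring

/-- Complex solutions of the `C₀`-equations are combinations of the joint family. [folklore] -/
theorem exists_coeff_z {z : γ → ℂ} (hz : ∀ c ∈ D₀.C, ∑ k, (c k : ℂ) * z k = 0) :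
    ∃ c : S.B' → ℂ, z = fun k => ∑ b, (S.mvv b k : ℂ) * c b := by
  have hmem : z ∈ solSpace ℚ (L := ℂ) (D₀.C : Set (γ → ℚ)) := by
    intro c hc
    simp only [pair, eq_ratCast]
    exact hz c hc
  rw [solSpace_eq_span] at hmem
  have hle : span ℂ (ofK ℚ (L := ℂ) ''
      {w : γ → ℚ | ∀ c ∈ (D₀.C : Set (γ → ℚ)), ∑ k, c k * w k = 0}) ≤
      span ℂ (Set.range fun b => fun k => (S.mvv b k : ℂ)) := by
    refine span_le.mpr ?_
    rintro _ ⟨w, hw, rfl⟩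
    have hw' := S.mvv_span w hw
    rw [Submodule.mem_span_range_iff_exists_fun] at hw'
    obtain ⟨r, hr⟩ := hw'
    have e : ofK ℚ (L := ℂ) w = ∑ b, (r b : ℂ) • fun k => (S.mvv b k : ℂ) := by
      funext k
      have := congr_fun hr k
      simp only [Finset.sum_apply, Pi.smul_apply, smul_eq_mul] at this
      simp only [ofK_apply, eq_ratCast, Finset.sum_apply, Pi.smul_apply, smul_eq_mul]
      rw [← this]; push_cast; rfl
    rw [e]
    exact Submodule.sum_mem _ fun b _ => Submodule.smul_mem _ _ (subset_span ⟨b, rfl⟩)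
  have := hle hmem
  rw [Submodule.mem_span_range_iff_exists_fun] at this
  obtain ⟨c, hc⟩ := this
  refine ⟨c, ?_⟩
  funext k
  have := congr_fun hc k
  simp only [Finset.sum_apply, Pi.smul_apply, smul_eq_mul] at this
  rw [← this]
  exact Finset.sum_congr rfl fun b _ => by ring

omit [Fintype J] in
/-- Complex solutions of the `Ξ₀`-equations are combinations of the `σ⁽ᵉ⁾`. [folklore] -/
theorem exists_coeff_s {s : δ → ℂ} (hs : ∀ ξ ∈ D₀.Ξ, ∑ x, (ξ x : ℂ) * s x = 0) :
    ∃ c : Fin S.nΞ → ℂ, s = fun x => ∑ e, (S.sv e x : ℂ) * c e := by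
  have hmem : s ∈ solSpace Kbar (L := ℂ) (D₀.Ξ : Set (δ → Kbar)) := by
    intro ξ hξ
    exact hs ξ hξ
  rw [solSpace_eq_span] at hmem
  have hle : span ℂ (ofK Kbar (L := ℂ) ''
      {w : δ → Kbar | ∀ ξ ∈ (D₀.Ξ : Set (δ → Kbar)), ∑ x, ξ x * w x = 0}) ≤
      span ℂ (Set.range fun e => fun x => (S.sv e x : ℂ)) := by
    refine span_le.mpr ?_
    rintro _ ⟨w, hw, rfl⟩
    have hw' := S.sv_span w hw
    rw [Submodule.mem_span_range_iff_exists_fun] at hw'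
    obtain ⟨r, hr⟩ := hw'
    have e : ofK Kbar (L := ℂ) w = ∑ e, (r e : ℂ) • fun x => (S.sv e x : ℂ) := by
      funext x
      have := congr_fun hr x
      simp only [Finset.sum_apply, Pi.smul_apply, smul_eq_mul] at this
      simp only [ofK_apply, Finset.sum_apply, Pi.smul_apply, smul_eq_mul]
      rw [← this, map_sum]
      exact Finset.sum_congr rfl fun e _ => by rw [map_mul]; rfl
    rw [e]
    exact Submodule.sum_mem _ fun e _ => Submodule.smul_mem _ _ (subset_span ⟨e, rfl⟩)
  have := hle hmem
  rw [Submodule.mem_span_range_iff_exists_fun] at this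
  obtain ⟨c, hc⟩ := this
  refine ⟨c, ?_⟩
  funext x
  have := congr_fun hc x
  simp only [Finset.sum_apply, Pi.smul_apply, smul_eq_mul] at this
  rw [← this]
  exact Finset.sum_congr rfl fun e _ => by ring

/-- **`ι` maps onto `Lie K₀`.** [folklore] -/
theorem exists_eq_ι {w : β ⊕ (γ ⊕ δ) → ℂ} (hw : w ∈ D₀.tangent) : ∃ w', S.ι w' = w := by
  obtain ⟨hA, hC, hΞ⟩ := (SubgroupData.mem_tangent_iff D₀ w).mp hw
  obtain ⟨cy, hcy⟩ := S.exists_coeff_y (y := fun i => w (iy i)) hA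
  obtain ⟨cz, hcz⟩ := S.exists_coeff_z (z := fun k => w (iz k)) hC
  obtain ⟨cs, hcs⟩ := S.exists_coeff_s (s := fun x => w (is x)) hΞ
  refine ⟨coords cy cz cs, ?_⟩
  funext t
  rcases t with i | k | x
  · show S.ι _ (iy i) = w (iy i)
    rw [ι_iy, show w (iy i) = ∑ j, (S.av j i : ℂ) * cy j from congr_fun hcy i]
    rfl
  · show S.ι _ (iz k) = w (iz k)
    rw [ι_iz, show w (iz k) = ∑ b, (S.mvv b k : ℂ) * cz b from congr_fun hcz k]
    rfl
  · show S.ι _ (is x) = w (is x)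
    rw [ι_is, show w (is x) = ∑ e, (S.sv e x : ℂ) * cs e from congr_fun hcs x]
    rfl

/-- The range of `ι` is `Lie K₀`. [folklore] -/
theorem range_ι : LinearMap.range S.ι = D₀.tangent := by
  refine le_antisymm ?_ fun w hw => ?_
  · rintro _ ⟨w', rfl⟩; exact S.ι_mem_tangent w'
  · obtain ⟨w', rfl⟩ := S.exists_eq_ι hw; exact LinearMap.mem_range_self _ _

/-- `dim(model of K₀) = dim K₀`. [folklore] -/
theorem card_eq : Fintype.card S.σ' = finrank ℂ ↥D₀.tangent := by
  rw [← S.range_ι, LinearMap.finrank_range_of_inj S.ι_injective, Module.finrank_fintype_fun_eq_card]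

omit [Fintype J] in
/-- **If the CM classes carry at most one block of `M`, they carry at most one block of the model
of `K₀`** (the classwise families `m⁽ⁱ,ᵇ⁾` are supported in `cls⁻¹(i)` and have left inverses).
[folklore] -/
theorem cls'_eq_imp {L : J → PeriodPair}
    (hcm1 : ∀ b b' : γ, cls b = cls b' → (L (cls b)).HasCM → b = b') :
    ∀ b b' : S.B', S.cls' b = S.cls' b' → (L (S.cls' b)).HasCM → b = b' := by
  classical
  rintro ⟨i, j⟩ ⟨i', j'⟩ h hCM
  change i = i' at h
  subst h
  change (L i).HasCM at hCM
  by_contra hne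
  have hjj : j ≠ j' := fun h => hne (by subst h; rfl)
  have h11 : ∑ k, S.mv i j k * S.pC i j k = 1 := by rw [S.pC_spec i j j]; simp
  have h01 : ∑ k, S.mv i j k * S.pC i j' k = 0 := by rw [S.pC_spec i j j']; simp [hjj]
  have h1' : ∑ k, S.mv i j' k * S.pC i j' k = 1 := by rw [S.pC_spec i j' j']; simp
  by_cases hex : ∃ k₀, cls k₀ = i
  · obtain ⟨k₀, hk₀⟩ := hex
    have huniq : ∀ k, cls k = i → k = k₀ := fun k hk =>
      hcm1 k k₀ (by rw [hk, hk₀]) (by rw [hk]; exact hCM)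
    have hred : ∀ (v : γ → ℤ) (q : γ → ℤ), (∀ k, cls k ≠ i → v k = 0) →
        ∑ k, v k * q k = v k₀ * q k₀ := by
      intro v q hv
      rw [Finset.sum_eq_single k₀]
      · intro k _ hk
        rw [hv k (fun h => hk (huniq k h)), zero_mul]
      · intro h; exact absurd (Finset.mem_univ k₀) h
    rw [hred _ _ (S.mv_supp i j)] at h11 h01
    rw [hred _ _ (S.mv_supp i j')] at h1'
    -- `m⁽ⁱ,ʲ⁾_{k₀} p_{k₀} = 1`, `m⁽ⁱ,ʲ⁾_{k₀} p'_{k₀} = 0`, `m⁽ⁱ,ʲ'⁾_{k₀} p'_{k₀} = 1`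
    have hm : S.mv i j k₀ ≠ 0 := fun h => by rw [h, zero_mul] at h11; exact zero_ne_one h11
    have hp' : S.pC i j' k₀ = 0 := (mul_eq_zero.mp h01).resolve_left hm
    rw [hp', mul_zero] at h1'
    exact zero_ne_one h1'
  · push Not at hex
    have : ∑ k, S.mv i j k * S.pC i j k = 0 :=
      Finset.sum_eq_zero fun k _ => by rw [S.mv_supp i j k (hex k), zero_mul]
    rw [this] at h11
    exact zero_ne_one h11

end SubData

end Sub

end Std

end GaGmEFam

end Literature.NumberTheory.Transcendental

end
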